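import Mathlib
import Summits.KontsevichZagierPeriods.Zeta5Search.SecondOrderTransfer
import Summits.KontsevichZagierPeriods.Zeta5Search.SecondOrderAggregate2
import HarnessLib

/-!
# ζ(5) search — THEOREM A‴ in its GENERAL form (criterion C2*, `SecondOrder.SecondOrderCollinearity`) IS A THEOREM

Cell `pub-zeta5` (HONEST FRAMING: systematic search; no irrationality claim unless certified), typer seat generation 11.
Discharges BY NAME `SecondOrder.SecondOrderCollinearity` of `Zeta5Search/SecondOrderDigit.lean` (REPORT-gen2-g10 §3, THEOREM A‴,
criterion C2*; exact random census 4,016 instances): window prime `5 ≤ p ≤ b₀ < p² − 2`, `M ≥ 6` even, multipole classes of exponent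
`≥ −M`, single-pole classes with `ν ≥ −M+1`, classes of exponent `−M` non-self-conjugate with palindromic type list, and the second-order
directions — `τ_x` for the deep classes, the `(ŵ, v̂)`-orbit vectors of the live sub-deep classes — pairwise collinear mod `p`
⟹ `v_p(Cas_j(b)) ≥ 6 − 2M` (= `casLB + 3`).
Proof: `aggregate₂` (file `SecondOrderAggregate2`) for `b` and for `b + e_j` (the regime transports, `H1_shift`, `H2_shift`,
`H3p_shift`) gives `W/(−p)^{m+3} ≡ −pX`, `V/(−p)^m ≡ −pY (mod p²)` with `(X, Y) ≡ U := Σ_z (d_z τ_z + c_z orbit_z)` and the same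
for `b + e_j` with ITS direction vectors, which are direction vectors of `b` (`deep_transfer`, `sub_transfer`, file
`SecondOrderTransfer`); the minor is `(−p)^{2m+3}(p²(X⁺Y − XY⁺) + O(p³))` and `X⁺Y − XY⁺ ≡ det(U⁺, U) = ΣΣ d⁺d·det(τ⁺, τ) + … ≡ 0`
termwise by the collinearity hypothesis (`det_small₂`, bilinear expansion).  `p`-adic valuations of rational numbers; nothing here
bears on irrationality.
-/

noncomputable section

open Finset

namespace Summit.KontsevichZagierPeriods.Zeta5Search.SecondOrder

open Summit.KontsevichZagierPeriods.Zeta5Search.DualSeries (InBox)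
open Summit.KontsevichZagierPeriods.Zeta5Search.WedgeDictionary (coeffW coeffV)
open Summit.KontsevichZagierPeriods.Zeta5Search.CasoratianValuation (InPolytope shift casoratian)
open Summit.KontsevichZagierPeriods.Zeta5Search.ClusterValuation
open Summit.KontsevichZagierPeriods.Zeta5Search.PadicSeries
open Summit.KontsevichZagierPeriods.Zeta5Search.BigPrime (shift_zero)

variable {p : ℕ} [hp : Fact p.Prime]

/-! ## §1 The determinant estimate with a small direction determinant -/

/-- **Second-order collinearity kills two digits** (general form): if `w ≡ −pX`, `v ≡ −pY`, `w' ≡ −pX'`, `v' ≡ −pY' (mod p²)` with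
integral `X, Y, X', Y'`, `(X, Y) ≡ (u₁, u₂)`, `(X', Y') ≡ (u₁', u₂') (mod p)` and `u₁'u₂ − u₁u₂' ≡ 0 (mod p)`, then
`‖w'v − wv'‖ ≤ p⁻³`. -/
theorem det_small₂ {w v w' v' X Y X' Y' u₁ u₂ u₁' u₂' : ℚ}
    (hw : padicNorm p (w + (p : ℚ) * X) ≤ (p : ℚ) ^ (-(2 : ℤ))) (hv : padicNorm p (v + (p : ℚ) * Y) ≤ (p : ℚ) ^ (-(2 : ℤ)))
    (hw' : padicNorm p (w' + (p : ℚ) * X') ≤ (p : ℚ) ^ (-(2 : ℤ))) (hv' : padicNorm p (v' + (p : ℚ) * Y') ≤ (p : ℚ) ^ (-(2 : ℤ)))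
    (hX : padicNorm p X ≤ 1) (hY : padicNorm p Y ≤ 1) (hX' : padicNorm p X' ≤ 1) (hY' : padicNorm p Y' ≤ 1)
    (hXa : padicNorm p (X - u₁) ≤ (p : ℚ) ^ (-(1 : ℤ))) (hYa : padicNorm p (Y - u₂) ≤ (p : ℚ) ^ (-(1 : ℤ)))
    (hXa' : padicNorm p (X' - u₁') ≤ (p : ℚ) ^ (-(1 : ℤ))) (hYa' : padicNorm p (Y' - u₂') ≤ (p : ℚ) ^ (-(1 : ℤ)))
    (hdir : padicNorm p (u₁' * u₂ - u₁ * u₂') ≤ (p : ℚ) ^ (-(1 : ℤ))) :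
    padicNorm p (w' * v - w * v') ≤ (p : ℚ) ^ (-(3 : ℤ)) := by
  have hpQ : (p : ℚ) ≠ 0 := Nat.cast_ne_zero.2 hp.out.ne_zero
  have hp1 : (1 : ℚ) ≤ p := one_le_p
  have hpn : padicNorm p (p : ℚ) = (p : ℚ) ^ (-(1 : ℤ)) := CellA.padicNorm_p
  set r₁ := w + (p : ℚ) * X
  set r₂ := v + (p : ℚ) * Y
  set r₃ := w' + (p : ℚ) * X'
  set r₄ := v' + (p : ℚ) * Y'
  set e₁ := X - u₁
  set e₂ := Y - u₂
  set e₃ := X' - u₁'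
  set e₄ := Y' - u₂'
  have hdet : X' * Y - X * Y' = u₁' * e₂ + e₃ * u₂ + e₃ * e₂ - u₁ * e₄ - e₁ * u₂' - e₁ * e₄ + (u₁' * u₂ - u₁ * u₂') := by
    simp only [e₁, e₂, e₃, e₄]; ring
  have hu : ∀ {Z e : ℚ}, padicNorm p Z ≤ 1 → padicNorm p e ≤ (p : ℚ) ^ (-(1 : ℤ)) → padicNorm p (Z - e) ≤ 1 :=
    fun hZ he => (padicNorm.sub (p := p)).trans (max_le hZ (he.trans (zpow_le_one_of_nonpos₀ hp1 (by norm_num))))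
  have hu₁ : padicNorm p u₁ ≤ 1 := by rw [show u₁ = X - e₁ by simp only [e₁]; ring]; exact hu hX hXa
  have hu₂ : padicNorm p u₂ ≤ 1 := by rw [show u₂ = Y - e₂ by simp only [e₂]; ring]; exact hu hY hYa
  have hu₁' : padicNorm p u₁' ≤ 1 := by rw [show u₁' = X' - e₃ by simp only [e₃]; ring]; exact hu hX' hXa'
  have hu₂' : padicNorm p u₂' ≤ 1 := by rw [show u₂' = Y' - e₄ by simp only [e₄]; ring]; exact hu hY' hYa'
  have hprod1 : ∀ {a c : ℚ}, padicNorm p a ≤ 1 → padicNorm p c ≤ (p : ℚ) ^ (-(1 : ℤ)) →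
      padicNorm p (a * c) ≤ (p : ℚ) ^ (-(1 : ℤ)) := fun ha hc => by
    rw [padicNorm.mul]
    calc _ ≤ (1 : ℚ) * (p : ℚ) ^ (-(1 : ℤ)) := mul_le_mul ha hc (padicNorm.nonneg _) zero_le_one
      _ = _ := one_mul _
  have hprod1' : ∀ {a c : ℚ}, padicNorm p a ≤ (p : ℚ) ^ (-(1 : ℤ)) → padicNorm p c ≤ 1 →
      padicNorm p (a * c) ≤ (p : ℚ) ^ (-(1 : ℤ)) := fun ha hc => by rw [mul_comm]; exact hprod1 hc ha
  have hee : ∀ {a c : ℚ}, padicNorm p a ≤ (p : ℚ) ^ (-(1 : ℤ)) → padicNorm p c ≤ (p : ℚ) ^ (-(1 : ℤ)) →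
      padicNorm p (a * c) ≤ (p : ℚ) ^ (-(1 : ℤ)) := fun ha hc =>
    hprod1 (ha.trans (zpow_le_one_of_nonpos₀ hp1 (by norm_num))) hc
  have hD : padicNorm p (X' * Y - X * Y') ≤ (p : ℚ) ^ (-(1 : ℤ)) := by
    rw [hdet]
    have k1 := hprod1 hu₁' hYa
    have k2 := hprod1' hXa' hu₂
    have k3 := hee hXa' hYa
    have k4 := hprod1 hu₁ hYa'
    have k5 := hprod1' hXa hu₂'
    have k6 := hee hXa hYa'
    have s2 := (padicNorm.nonarchimedean (p := p)).trans (max_le k1 k2)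
    have s3 := (padicNorm.nonarchimedean (p := p)).trans (max_le s2 k3)
    have s4 := (padicNorm.sub (p := p)).trans (max_le s3 k4)
    have s5 := (padicNorm.sub (p := p)).trans (max_le s4 k5)
    have s6 := (padicNorm.sub (p := p)).trans (max_le s5 k6)
    exact (padicNorm.nonarchimedean (p := p)).trans (max_le s6 hdir)
  have hexp : w' * v - w * v' = (p : ℚ) ^ 2 * (X' * Y - X * Y') + (r₃ * r₂ - r₁ * r₄)
      + (p : ℚ) * (-(r₃ * Y) - X' * r₂ + r₁ * Y' + X * r₄) := by
    simp only [r₁, r₂, r₃, r₄]; ring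
  have h2le : ∀ {a c : ℚ}, padicNorm p a ≤ (p : ℚ) ^ (-(2 : ℤ)) → padicNorm p c ≤ 1 →
      padicNorm p (a * c) ≤ (p : ℚ) ^ (-(2 : ℤ)) := fun ha hc => by
    rw [padicNorm.mul]
    calc _ ≤ (p : ℚ) ^ (-(2 : ℤ)) * 1 := mul_le_mul ha hc (padicNorm.nonneg _) (zpow_p_nonneg _)
      _ = _ := mul_one _
  have h2le' : ∀ {a c : ℚ}, padicNorm p a ≤ 1 → padicNorm p c ≤ (p : ℚ) ^ (-(2 : ℤ)) →
      padicNorm p (a * c) ≤ (p : ℚ) ^ (-(2 : ℤ)) := fun ha hc => by rw [mul_comm]; exact h2le hc ha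
  have hrr : ∀ {a c : ℚ}, padicNorm p a ≤ (p : ℚ) ^ (-(2 : ℤ)) → padicNorm p c ≤ (p : ℚ) ^ (-(2 : ℤ)) →
      padicNorm p (a * c) ≤ (p : ℚ) ^ (-(3 : ℤ)) := fun ha hc => by
    rw [padicNorm.mul]
    calc _ ≤ (p : ℚ) ^ (-(2 : ℤ)) * (p : ℚ) ^ (-(2 : ℤ)) := mul_le_mul ha hc (padicNorm.nonneg _) (zpow_p_nonneg _)
      _ = (p : ℚ) ^ (-(4 : ℤ)) := by rw [← zpow_add₀ hpQ]; norm_num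
      _ ≤ _ := zpow_le_zpow_right₀ hp1 (by norm_num)
  have t1 : padicNorm p ((p : ℚ) ^ 2 * (X' * Y - X * Y')) ≤ (p : ℚ) ^ (-(3 : ℤ)) := by
    rw [padicNorm.mul, CellA.padicNorm_pow_eq, hpn]
    calc _ ≤ ((p : ℚ) ^ (-(1 : ℤ))) ^ 2 * (p : ℚ) ^ (-(1 : ℤ)) := mul_le_mul_of_nonneg_left hD (by positivity)
      _ = (p : ℚ) ^ (-(3 : ℤ)) := by rw [← zpow_natCast, ← zpow_mul, ← zpow_add₀ hpQ]; norm_num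
  have t2 : padicNorm p (r₃ * r₂ - r₁ * r₄) ≤ (p : ℚ) ^ (-(3 : ℤ)) :=
    (padicNorm.sub (p := p)).trans (max_le (hrr hw' hv) (hrr hw hv'))
  have hin : padicNorm p (-(r₃ * Y) - X' * r₂ + r₁ * Y' + X * r₄) ≤ (p : ℚ) ^ (-(2 : ℤ)) := by
    have k1 : padicNorm p (-(r₃ * Y)) ≤ (p : ℚ) ^ (-(2 : ℤ)) := by rw [padicNorm.neg]; exact h2le hw' hY
    have k2 := h2le' hX' hv
    have k3 := h2le hw hY'
    have k4 := h2le' hX hv'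
    have s2 := (padicNorm.sub (p := p)).trans (max_le k1 k2)
    have s3 := (padicNorm.nonarchimedean (p := p)).trans (max_le s2 k3)
    exact (padicNorm.nonarchimedean (p := p)).trans (max_le s3 k4)
  have t3 : padicNorm p ((p : ℚ) * (-(r₃ * Y) - X' * r₂ + r₁ * Y' + X * r₄)) ≤ (p : ℚ) ^ (-(3 : ℤ)) := by
    rw [padicNorm.mul, hpn]
    calc _ ≤ (p : ℚ) ^ (-(1 : ℤ)) * (p : ℚ) ^ (-(2 : ℤ)) := mul_le_mul_of_nonneg_left hin (zpow_p_nonneg _)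
      _ = _ := by rw [← zpow_add₀ hpQ]; norm_num
  rw [hexp]
  have s2 := (padicNorm.nonarchimedean (p := p)).trans (max_le t1 t2)
  exact (padicNorm.nonarchimedean (p := p)).trans (max_le s2 t3)

/-- A product `αβd` with integral `α, β` is `O(p)` as soon as `d` is `O(p)` whenever both coefficients are non-zero. -/
theorem padicNorm_coeff_mul_le {α β d : ℚ} (hα : padicNorm p α ≤ 1) (hβ : padicNorm p β ≤ 1)
    (hd : α ≠ 0 → β ≠ 0 → padicNorm p d ≤ (p : ℚ) ^ (-(1 : ℤ))) :
    padicNorm p (α * β * d) ≤ (p : ℚ) ^ (-(1 : ℤ)) := by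
  by_cases hα0 : α = 0
  · rw [hα0, zero_mul, zero_mul, padicNorm.zero]; exact zpow_p_nonneg _
  by_cases hβ0 : β = 0
  · rw [hβ0, mul_zero, zero_mul, padicNorm.zero]; exact zpow_p_nonneg _
  rw [padicNorm.mul, padicNorm.mul]
  calc _ ≤ (1 : ℚ) * 1 * (p : ℚ) ^ (-(1 : ℤ)) :=
        mul_le_mul (mul_le_mul hα hβ (padicNorm.nonneg _) zero_le_one) (hd hα0 hβ0) (padicNorm.nonneg _) (by norm_num)
    _ = _ := by ring

/-- `det = 0 ∨ v_p(det) ≥ 1` gives `‖det‖ ≤ p⁻¹`. -/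
theorem padicNorm_le_of_zero_or_val {d : ℚ} (h : d = 0 ∨ 1 ≤ padicValRat p d) : padicNorm p d ≤ (p : ℚ) ^ (-(1 : ℤ)) := by
  by_cases hd : d = 0
  · rw [hd, padicNorm.zero]; exact zpow_p_nonneg _
  rcases h with h | h
  · exact absurd h hd
  rw [padicNorm.eq_zpow_of_nonzero hd]
  exact zpow_le_zpow_right₀ one_le_p (by omega)

/-! ## §2 THEOREM A‴, general form -/

/-- **THEOREM A‴ in its general form (criterion C2*, `SecondOrderCollinearity`, gen-2 g10) is a theorem.** -/
theorem secondOrderCollinearity_holds : SecondOrderCollinearity := by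
  intro b p j M hb hb' hj1 hj7 hprime hp5 hpb hwin hM hMe H1 H2 H3 HC hcas
  haveI : Fact p.Prime := ⟨hprime⟩
  have hp0 : (p : ℚ) ≠ 0 := Nat.cast_ne_zero.2 hprime.ne_zero
  have hpneg : (-(p : ℚ)) ≠ 0 := neg_ne_zero.2 hp0
  have hp2 : p ≠ 2 := by omega
  -- the aggregates for `b` and `b + e_j`
  obtain ⟨X, Y, dC, hX1, hY1, hW, hV, hd1, hdD, hXa, hYa⟩ := aggregate₂ b hb hp5 hpb hwin hM hMe H1 H2 H3
  have hpb' : (p : ℤ) ≤ shift b j 0 := by rw [shift_zero b hj1]; exact hpb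
  have hwin' : (shift b j 0 + 2 : ℤ) < (p : ℤ) ^ 2 := by rw [shift_zero b hj1]; exact hwin
  obtain ⟨X', Y', dC', hX1', hY1', hW', hV', hd1', hdD', hXa', hYa'⟩ := aggregate₂ (shift b j) hb' hp5 hpb' hwin' hM hMe
    (H1_shift b hb hj1 H1) (H2_shift b hb hb' hj1 hj7 hM H1 H2) (H3p_shift b hb hb' hj1 hj7 hpb H1 H3)
  -- ### the direction vectors of `b + e_j` are direction vectors of `b`; all cross determinants are `O(p)`
  have hHC : ∀ v w : ℚ × ℚ,
      ((∃ x ∈ multipoleClasses b p, classExp b p x = -(M : ℤ) ∧ v = (tauW b p x, tauV b p x)) ∨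
        (∃ y, y < p ∧ 1 ≤ classPoleCount b p y ∧ classNu b p y = -(M : ℤ) + 1 ∧ v = (orbitW b p y, orbitV b p y))) →
      ((∃ x ∈ multipoleClasses b p, classExp b p x = -(M : ℤ) ∧ w = (tauW b p x, tauV b p x)) ∨
        (∃ y, y < p ∧ 1 ≤ classPoleCount b p y ∧ classNu b p y = -(M : ℤ) + 1 ∧ w = (orbitW b p y, orbitV b p y))) →
      padicNorm p (v.1 * w.2 - v.2 * w.1) ≤ (p : ℚ) ^ (-(1 : ℤ)) :=
    fun v w hv hw => padicNorm_le_of_zero_or_val (HC v w hv hw)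
  -- membership of the four families
  have hmD : ∀ z, dC z ≠ 0 →
      (∃ x ∈ multipoleClasses b p, classExp b p x = -(M : ℤ) ∧ (tauW b p z, tauV b p z) = (tauW b p x, tauV b p x)) ∨
        (∃ y, y < p ∧ 1 ≤ classPoleCount b p y ∧ classNu b p y = -(M : ℤ) + 1 ∧
          (tauW b p z, tauV b p z) = (orbitW b p y, orbitV b p y)) := fun z hz => by
    obtain ⟨hm, hE⟩ := hdD z hz
    exact Or.inl ⟨z, hm, hE, rfl⟩
  have hmC : ∀ z, z < p → liveCoeff b p M z ≠ 0 →
      (∃ x ∈ multipoleClasses b p, classExp b p x = -(M : ℤ) ∧ (orbitW b p z, orbitV b p z) = (tauW b p x, tauV b p x)) ∨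
        (∃ y, y < p ∧ 1 ≤ classPoleCount b p y ∧ classNu b p y = -(M : ℤ) + 1 ∧
          (orbitW b p z, orbitV b p z) = (orbitW b p y, orbitV b p y)) := fun z hz hc => by
    obtain ⟨h1, hnu⟩ := liveCoeff_ne_zero hc
    exact Or.inr ⟨z, hz, h1, hnu, rfl⟩
  have hmD' : ∀ z, dC' z ≠ 0 →
      (∃ x ∈ multipoleClasses b p, classExp b p x = -(M : ℤ) ∧
          (tauW (shift b j) p z, tauV (shift b j) p z) = (tauW b p x, tauV b p x)) ∨
        (∃ y, y < p ∧ 1 ≤ classPoleCount b p y ∧ classNu b p y = -(M : ℤ) + 1 ∧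
          (tauW (shift b j) p z, tauV (shift b j) p z) = (orbitW b p y, orbitV b p y)) := fun z hz => by
    obtain ⟨hm, hE⟩ := hdD' z hz
    obtain ⟨hmb, hEb, htw, htv⟩ := deep_transfer b hb hj1 H1 hm hE
    exact Or.inl ⟨z, hmb, hEb, by rw [htw, htv]⟩
  have hmC' : ∀ z, z < p → liveCoeff (shift b j) p M z ≠ 0 →
      (∃ x ∈ multipoleClasses b p, classExp b p x = -(M : ℤ) ∧
          (orbitW (shift b j) p z, orbitV (shift b j) p z) = (tauW b p x, tauV b p x)) ∨
        (∃ y, y < p ∧ 1 ≤ classPoleCount b p y ∧ classNu b p y = -(M : ℤ) + 1 ∧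
          (orbitW (shift b j) p z, orbitV (shift b j) p z) = (orbitW b p y, orbitV b p y)) := fun z hz hc => by
    obtain ⟨h1, hnu⟩ := liveCoeff_ne_zero hc
    rcases sub_transfer b hb hb' hj1 hj7 hpb hM hMe H1 H2 H3 hz h1 hnu with ⟨h1b, hnub, how, hov⟩ | ⟨hmb, hEb, how, hov⟩
    · exact Or.inr ⟨z, hz, h1b, hnub, by rw [how, hov]⟩
    · exact Or.inl ⟨z, hmb, hEb, by rw [how, hov]⟩
  -- integrality of the coefficients
  have hg1 : ∀ z, z < p → padicNorm p (gHat b p z) ≤ 1 := fun z hz =>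
    LevelClass.padicNorm_gHat_le_one b hb hp5 hz
      (mem_filter.2 ⟨mem_range.2 (by have := le_b0_of_lt b hpb hz; omega), rfl⟩)
  have hg1' : ∀ z, z < p → padicNorm p (gHat (shift b j) p z) ≤ 1 := fun z hz =>
    LevelClass.padicNorm_gHat_le_one (shift b j) hb' hp5 hz
      (mem_filter.2 ⟨mem_range.2 (by have := le_b0_of_lt (shift b j) hpb' hz; omega), rfl⟩)
  have hc1 : ∀ z, z < p → padicNorm p (liveCoeff b p M z) ≤ 1 := fun z hz =>
    padicNorm_liveCoeff_le b M z (hg1 z hz) hp2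
  have hc1' : ∀ z, z < p → padicNorm p (liveCoeff (shift b j) p M z) ≤ 1 := fun z hz =>
    padicNorm_liveCoeff_le (shift b j) M z (hg1' z hz) hp2
  -- ### the direction determinant `u₁'u₂ − u₁u₂'` is `O(p)`
  set F₁ : ℕ → ℚ := fun z => dC z * tauW b p z + liveCoeff b p M z * orbitW b p z with hF₁
  set F₂ : ℕ → ℚ := fun z => dC z * tauV b p z + liveCoeff b p M z * orbitV b p z with hF₂
  set G₁ : ℕ → ℚ := fun z => dC' z * tauW (shift b j) p z + liveCoeff (shift b j) p M z * orbitW (shift b j) p z with hG₁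
  set G₂ : ℕ → ℚ := fun z => dC' z * tauV (shift b j) p z + liveCoeff (shift b j) p M z * orbitV (shift b j) p z with hG₂
  have hdir : padicNorm p ((∑ z ∈ range p, G₁ z) * (∑ z ∈ range p, F₂ z) - (∑ z ∈ range p, F₁ z) * (∑ z ∈ range p, G₂ z))
      ≤ (p : ℚ) ^ (-(1 : ℤ)) := by
    rw [mul_comm (∑ z ∈ range p, F₁ z), sum_mul_sum, sum_mul_sum, ← sum_sub_distrib]
    refine padicNorm.sum_le' (fun k hk => ?_) (zpow_p_nonneg _)
    rw [← sum_sub_distrib]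
    refine padicNorm.sum_le' (fun i hi => ?_) (zpow_p_nonneg _)
    have hkp := mem_range.1 hk
    have hip := mem_range.1 hi
    have e : G₁ k * F₂ i - G₂ k * F₁ i =
        dC' k * dC i * (tauW (shift b j) p k * tauV b p i - tauV (shift b j) p k * tauW b p i)
        + dC' k * liveCoeff b p M i * (tauW (shift b j) p k * orbitV b p i - tauV (shift b j) p k * orbitW b p i)
        + liveCoeff (shift b j) p M k * dC i *
            (orbitW (shift b j) p k * tauV b p i - orbitV (shift b j) p k * tauW b p i)
        + liveCoeff (shift b j) p M k * liveCoeff b p M i *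
            (orbitW (shift b j) p k * orbitV b p i - orbitV (shift b j) p k * orbitW b p i) := by
      simp only [hF₁, hF₂, hG₁, hG₂]; ring
    rw [e]
    have k1 := padicNorm_coeff_mul_le (hd1' k) (hd1 i) fun hα hβ =>
      hHC (tauW (shift b j) p k, tauV (shift b j) p k) (tauW b p i, tauV b p i) (hmD' k hα) (hmD i hβ)
    have k2 := padicNorm_coeff_mul_le (hd1' k) (hc1 i hip) fun hα hβ =>
      hHC (tauW (shift b j) p k, tauV (shift b j) p k) (orbitW b p i, orbitV b p i) (hmD' k hα) (hmC i hip hβ)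
    have k3 := padicNorm_coeff_mul_le (hc1' k hkp) (hd1 i) fun hα hβ =>
      hHC (orbitW (shift b j) p k, orbitV (shift b j) p k) (tauW b p i, tauV b p i) (hmC' k hkp hα) (hmD i hβ)
    have k4 := padicNorm_coeff_mul_le (hc1' k hkp) (hc1 i hip) fun hα hβ =>
      hHC (orbitW (shift b j) p k, orbitV (shift b j) p k) (orbitW b p i, orbitV b p i) (hmC' k hkp hα) (hmC i hip hβ)
    have s2 := (padicNorm.nonarchimedean (p := p)).trans (max_le k1 k2)
    have s3 := (padicNorm.nonarchimedean (p := p)).trans (max_le s2 k3)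
    exact (padicNorm.nonarchimedean (p := p)).trans (max_le s3 k4)
  -- ### the minor
  set w := coeffW b / (-(p : ℚ)) ^ (-(M : ℤ) + 3)
  set v := coeffV b / (-(p : ℚ)) ^ (-(M : ℤ))
  set w' := coeffW (shift b j) / (-(p : ℚ)) ^ (-(M : ℤ) + 3)
  set v' := coeffV (shift b j) / (-(p : ℚ)) ^ (-(M : ℤ))
  have hdet := det_small₂ hW hV hW' hV' hX1 hY1 hX1' hY1' hXa hYa hXa' hYa' hdir
  have hcasE : casoratian b j = (-(p : ℚ)) ^ (-(M : ℤ) + 3) * (-(p : ℚ)) ^ (-(M : ℤ)) * (w' * v - w * v') := by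
    have e1 : coeffW b = w * (-(p : ℚ)) ^ (-(M : ℤ) + 3) := by
      simp only [w]; rw [div_mul_cancel₀ _ (zpow_ne_zero _ hpneg)]
    have e2 : coeffV b = v * (-(p : ℚ)) ^ (-(M : ℤ)) := by
      simp only [v]; rw [div_mul_cancel₀ _ (zpow_ne_zero _ hpneg)]
    have e3 : coeffW (shift b j) = w' * (-(p : ℚ)) ^ (-(M : ℤ) + 3) := by
      simp only [w']; rw [div_mul_cancel₀ _ (zpow_ne_zero _ hpneg)]
    have e4 : coeffV (shift b j) = v' * (-(p : ℚ)) ^ (-(M : ℤ)) := by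
      simp only [v']; rw [div_mul_cancel₀ _ (zpow_ne_zero _ hpneg)]
    unfold casoratian
    rw [e1, e2, e3, e4]; ring
  apply val_ge_of_padicNorm_le hcas
  rw [hcasE, padicNorm.mul, padicNorm.mul, LevelClass.padicNorm_neg_p_zpow, LevelClass.padicNorm_neg_p_zpow]
  calc (p : ℚ) ^ (-(-(M : ℤ) + 3)) * (p : ℚ) ^ (-(-(M : ℤ))) * padicNorm p (w' * v - w * v')
      ≤ (p : ℚ) ^ (-(-(M : ℤ) + 3)) * (p : ℚ) ^ (-(-(M : ℤ))) * (p : ℚ) ^ (-(3 : ℤ)) :=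
        mul_le_mul_of_nonneg_left hdet (mul_nonneg (zpow_p_nonneg _) (zpow_p_nonneg _))
    _ = (p : ℚ) ^ (-((6 : ℤ) - 2 * M)) := by
        rw [← zpow_add₀ hp0, ← zpow_add₀ hp0]; congr 1; ring

end Summit.KontsevichZagierPeriods.Zeta5Search.SecondOrder

end
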